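import Literature.Geometry.Kaehler.ComplexTorusCMTypeModelsHodgeClassesDegreeLeSix
import Literature.Geometry.Kaehler.ComplexTorusCyclotomicAutomorphismOrderSixteenHodge
import Literature.Geometry.Kaehler.ComplexTorusCyclotomicCharpolyFifteenHodge
import Literature.Geometry.Kaehler.ComplexTorusCyclotomicCharpolyTwentyHodge
import Literature.Geometry.Kaehler.ComplexTorusCyclotomicCharpolyTwentyFourHodge
import Literature.Geometry.Kaehler.ComplexTorusCyclotomicCharpolyThirty
import HarnessLib

/-!
# `Hdg = Div` on all powers of every complex torus of dimension `≤ 4` with an endomorphism of cyclotomic characteristic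
# polynomial `Φ_d`, `d > 2` (all `d` with `φ(d) ≤ 8`)

Layer `Literature/Geometry/Kaehler`, namespace `Literature.Geometry.Kaehler.ComplexTorus`; lane `lit-hodgefound` (Track 2
foundations library), prover seat `lit-hodgefound-p10`, generation 33, row «A2-26(hb)» (self-proposed 2026-08-28) — the capstone
of the generation.  Theorems only; no `def`, no instance, no named fact (net Literature debt 0).

A complex torus `X = E/Λ` with an endomorphism `u` whose rational representation has characteristic polynomial `Φ_d` (`d > 2`)
has `rk Λ = φ(d)`, `dim X = φ(d)/2`, and is `≅ ℂ^g/Φ(𝔞)` for a CM type `Φ` of `ℚ(ζ_d)` (generation 31).  `dim X ≤ 4` means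
`φ(d) ≤ 8`; `φ(d) ≤ 6` is this generation's `…HodgeClassesDegreeLeSix` (any CM field of degree `≤ 6`), and `φ(d) = 8` means
`d ∈ {15, 16, 20, 24, 30}` (§1, elementary: `p ∣ d ⟹ (p − 1) ∣ 8`, `p² ∣ d ⟹ p(p − 1) ∣ 8`, so `d ∣ 2⁴·3·5 = 240`, then
inspection of the divisors of `240`) — the five files `…OrderSixteenHodge`, `…CharpolyFifteenHodge`, `…CharpolyTwentyHodge`,
`…CharpolyTwentyFourHodge`, `…CharpolyThirty` of this generation (rank certificates for the primitive types of the four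
cyclotomic fields of degree `8`, the imprimitive kinds `∼ B²`, `∼ E⁴` transported along isogenies, `Φ₃₀(X) = Φ₁₅(−X)`).

* §1 `dvd_of_totient_eq_eight` (`φ(d) = 8 ⟹ d ∣ 240`), **`eq_of_totient_eq_eight`** (`φ(d) = 8 ⟺ d ∈ {15, 16, 20, 24, 30}`),
  `totient_eq_eight_iff`.
* §2 **`divisorClasses_powPeriod_eq_hodgeClasses_of_charpoly_eq_cyclotomic_of_totient_eq_eight`**,
  **`divisorClasses_powPeriod_eq_hodgeClasses_of_charpoly_eq_cyclotomic_of_totient_le_eight`** and the dimension form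
  **`divisorClasses_powPeriod_eq_hodgeClasses_of_charpoly_eq_cyclotomic_of_finrank_le_four`**: for EVERY complex torus `X` of
  dimension `≤ 4` carrying an endomorphism with `P_u = Φ_d`, `d > 2`, and every `k`, the Hodge classes of `Xᵏ` are generated
  by divisor classes (in particular intersections of divisors; no exceptional Hodge classes occur on any power).

## References

* [MoonenZarhin1999LowDim] B. Moonen, Yu. Zarhin, *Hodge classes on abelian varieties of low dimension*, Math. Ann. 315
  (1999), Thm. 0.1, (0.2)(4).
* [Dodson1984] B. Dodson, *The structure of Galois groups of CM-fields*, Trans. AMS 283 (1984), §3.3.2 Theorem p. 16.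
* [Shimura1998] G. Shimura, *Abelian Varieties with Complex Multiplication and Modular Functions* (1998), §6.1 Thm. 2,
  §6.2 Thm. 3, §8.4 Examples (1)–(2).
* [BirkenhakeLange2004] Ch. Birkenhake, H. Lange, *Complex Abelian Varieties*, 2nd ed. (2004), §13.3.
* [Washington1997] L. C. Washington, *Introduction to Cyclotomic Fields*, 2nd ed. (1997), Ch. 2 (`φ`, `Φ_n`).
-/

noncomputable section

open scoped Classical nonZeroDivisors NumberField Manifold ContDiff MatrixGroups
open NumberField Module Polynomial

namespace Literature.Geometry.Kaehler

namespace ComplexTorus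

/-! ### §1 `φ(d) = 8 ⟺ d ∈ {15, 16, 20, 24, 30}` -/

/-- **`φ(d) = 8 ⟹ d ∣ 240 = 2⁴·3·5`**: a prime `p ∣ d` has `p − 1 = φ(p) ∣ φ(d) = 8`, so `p ∈ {2, 3, 5}`; `p^k ∣ d` gives
`φ(p^k) = p^{k−1}(p − 1) ∣ 8`, so `k ≤ 4` for `p = 2` and `k ≤ 1` for `p = 3, 5`. [cite: Washington1997, Ch. 2] [folklore] -/
theorem dvd_of_totient_eq_eight {d : ℕ} (h : Nat.totient d = 8) : d ∣ 240 := by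
  have hd0 : d ≠ 0 := by rintro rfl; simp at h
  rw [← Nat.factorization_le_iff_dvd hd0 (by norm_num), Finsupp.le_def]
  intro p
  by_cases hp : p.Prime
  swap
  · rw [Nat.factorization_eq_zero_of_not_prime d hp]; exact Nat.zero_le _
  set k := d.factorization p with hk
  rcases Nat.eq_zero_or_pos k with hk0 | hkpos
  · rw [hk0]; exact Nat.zero_le _
  -- `p ^ k ∣ d`, so `φ(p^k) = p^(k-1) (p-1) ∣ 8`
  have hpk : p ^ k ∣ d := Nat.ordProj_dvd d p
  have hφ : p ^ (k - 1) * (p - 1) ∣ 8 := by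
    rw [← Nat.totient_prime_pow hp hkpos, ← h]; exact Nat.totient_dvd_of_dvd hpk
  have hp1 : p - 1 ∣ 8 := (Dvd.intro_left _ rfl).trans hφ
  have hp9 : p ≤ 9 := by have := Nat.le_of_dvd (by norm_num) hp1; omega
  have hpow : p ^ (k - 1) ∣ 8 := (Dvd.intro _ rfl).trans hφ
  have hpowle : p ^ (k - 1) ≤ 8 := Nat.le_of_dvd (by norm_num) hpow
  -- goal: `k ≤ (240).factorization p`, i.e. `p ^ k ∣ 240`
  rw [← hp.pow_dvd_iff_le_factorization (by norm_num)]
  have h2 := hp.two_le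
  interval_cases p
  · -- p = 2 : k ≤ 4
    have hk4 : k ≤ 4 := by
      by_contra hc
      push Not at hc
      have h16 : 2 ^ 4 ≤ 2 ^ (k - 1) := Nat.pow_le_pow_right (by norm_num) (by omega)
      omega
    exact (pow_dvd_pow 2 hk4).trans (by norm_num)
  · -- p = 3 : k = 1
    have hk1 : k = 1 := by
      by_contra hc
      have h3 : 3 ^ 1 ≤ 3 ^ (k - 1) := Nat.pow_le_pow_right (by norm_num) (by omega)
      have h3' : (3 : ℕ) ∣ 8 := (pow_dvd_pow 3 (show 1 ≤ k - 1 by omega)).trans (by simpa using hpow)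
      omega
    rw [hk1]; norm_num
  · exact absurd hp (by norm_num)
  · -- p = 5 : k = 1
    have hk1 : k = 1 := by
      by_contra hc
      have h5' : (5 : ℕ) ∣ 8 := (pow_dvd_pow 5 (show 1 ≤ k - 1 by omega)).trans (by simpa using hpow)
      omega
    rw [hk1]; norm_num
  · exact absurd hp (by norm_num)
  · -- p = 7 : `6 ∣ 8`, impossible
    omega
  · exact absurd hp (by norm_num)
  · exact absurd hp (by norm_num)

/-- **`φ(d) = 8 ⟹ d ∈ {15, 16, 20, 24, 30}`** (inspection of the divisors of `240`). [cite: Washington1997, Ch. 2] [folklore] -/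
theorem eq_of_totient_eq_eight {d : ℕ} (h : Nat.totient d = 8) : d = 15 ∨ d = 16 ∨ d = 20 ∨ d = 24 ∨ d = 30 := by
  have hmem : d ∈ Nat.divisors 240 := Nat.mem_divisors.2 ⟨dvd_of_totient_eq_eight h, by norm_num⟩
  have key : ∀ x ∈ Nat.divisors 240, Nat.totient x = 8 → x = 15 ∨ x = 16 ∨ x = 20 ∨ x = 24 ∨ x = 30 := by decide
  exact key d hmem h

/-- **`φ(d) = 8 ⟺ d ∈ {15, 16, 20, 24, 30}`.** [cite: Washington1997, Ch. 2] [folklore] -/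
theorem totient_eq_eight_iff {d : ℕ} : Nat.totient d = 8 ↔ d = 15 ∨ d = 16 ∨ d = 20 ∨ d = 24 ∨ d = 30 := by
  refine ⟨eq_of_totient_eq_eight, ?_⟩
  rintro (rfl | rfl | rfl | rfl | rfl) <;> decide

/-! ### §2 `Hdg(Xᵏ) = Div(Xᵏ)` for every complex torus of dimension `≤ 4` with `P_u = Φ_d`, `d > 2` -/

section Tori

variable {ι : Type} [Fintype ι] [DecidableEq ι] {E : Type} [NormedAddCommGroup E] [NormedSpace ℂ E]
  {P : (ι → ℝ) ≃L[ℝ] E} {d : ℕ}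

/-- **`Hdg(Xᵏ) = Div(Xᵏ)` FOR ALL `k`, FOR EVERY COMPLEX TORUS WITH AN ENDOMORPHISM OF CHARACTERISTIC POLYNOMIAL `Φ_d`, `φ(d) = 8`**
(`d ∈ {15, 16, 20, 24, 30}`: the five degree-`8` files of this generation). [cite: MoonenZarhin1999LowDim, Thm. 0.1]
[cite: Dodson1984, §3.3.2 Theorem (p. 16)] [cite: Shimura1998, §8.4 Examples (1)–(2)] [cite: BirkenhakeLange2004, §13.3] -/
theorem divisorClasses_powPeriod_eq_hodgeClasses_of_charpoly_eq_cyclotomic_of_totient_eq_eight {A : Matrix ι ι ℤ}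
    (hA : A ∈ endRingInt P) (hP : A.charpoly = cyclotomic d ℤ) (h8 : Nat.totient d = 8) (k p : ℕ) :
    divisorClasses (powPeriod P k) p = hodgeClasses (powPeriod P k) p := by
  rcases eq_of_totient_eq_eight h8 with rfl | rfl | rfl | rfl | rfl
  · exact divisorClasses_powPeriod_eq_hodgeClasses_of_charpoly_eq_cyclotomic_fifteen hA hP k p
  · have hdim : finrank ℂ E = 4 := by
      have h := two_mul_finrank_eq_totient_of_charpoly_eq_cyclotomic P hP
      have h16 : Nat.totient 16 = 8 := by decide
      omega
    exact divisorClasses_powPeriod_eq_hodgeClasses_of_orderOf_eq_sixteen hA (orderOf_eq_of_charpoly_eq_cyclotomic hA hP)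
      hdim k p
  · exact divisorClasses_powPeriod_eq_hodgeClasses_of_charpoly_eq_cyclotomic_twenty hA hP k p
  · exact divisorClasses_powPeriod_eq_hodgeClasses_of_charpoly_eq_cyclotomic_twentyFour hA hP k p
  · exact divisorClasses_powPeriod_eq_hodgeClasses_of_charpoly_eq_cyclotomic_thirty hA hP k p

/-- **`Hdg(Xᵏ) = Div(Xᵏ)` FOR ALL `k`, FOR EVERY COMPLEX TORUS WITH AN ENDOMORPHISM OF CHARACTERISTIC POLYNOMIAL `Φ_d`, `d > 2`,
`φ(d) ≤ 8`** (`φ(d) ≤ 6`: `…HodgeClassesDegreeLeSix`; `φ(d)` is even for `d > 2`, so otherwise `φ(d) = 8`).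
[cite: MoonenZarhin1999LowDim, Thm. 0.1, (0.2)(4)] [cite: Dodson1984, §3.3.2 Theorem (p. 16)] [cite: BirkenhakeLange2004, §13.3] -/
theorem divisorClasses_powPeriod_eq_hodgeClasses_of_charpoly_eq_cyclotomic_of_totient_le_eight (hd : 2 < d) {A : Matrix ι ι ℤ}
    (hA : A ∈ endRingInt P) (hP : A.charpoly = cyclotomic d ℤ) (h8 : Nat.totient d ≤ 8) (k p : ℕ) :
    divisorClasses (powPeriod P k) p = hodgeClasses (powPeriod P k) p := by
  haveI : NeZero d := ⟨by omega⟩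
  by_cases h6 : Nat.totient d ≤ 6
  · exact divisorClasses_powPeriod_eq_hodgeClasses_of_charpoly_eq_cyclotomic_of_totient_le_six hd hA hP h6 k p
  · have h8' : Nat.totient d = 8 := by
      obtain ⟨r, hr⟩ := Nat.totient_even hd
      omega
    exact divisorClasses_powPeriod_eq_hodgeClasses_of_charpoly_eq_cyclotomic_of_totient_eq_eight hA hP h8' k p

/-- **`Hdg(Xᵏ) = Div(Xᵏ)` FOR ALL `k`, FOR EVERY COMPLEX TORUS OF DIMENSION `≤ 4` WITH AN ENDOMORPHISM OF CYCLOTOMIC CHARACTERISTIC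
POLYNOMIAL `Φ_d`, `d > 2`** (`2 dim X = φ(d)`). [cite: MoonenZarhin1999LowDim, Thm. 0.1, (0.2)(4)] [cite: Dodson1984, §3.3.2 Theorem (p. 16)]
[cite: BirkenhakeLange2004, §13.3] -/
theorem divisorClasses_powPeriod_eq_hodgeClasses_of_charpoly_eq_cyclotomic_of_finrank_le_four (hd : 2 < d) {A : Matrix ι ι ℤ}
    (hA : A ∈ endRingInt P) (hP : A.charpoly = cyclotomic d ℤ) (h4 : finrank ℂ E ≤ 4) (k p : ℕ) :
    divisorClasses (powPeriod P k) p = hodgeClasses (powPeriod P k) p := by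
  have h := two_mul_finrank_eq_totient_of_charpoly_eq_cyclotomic P hP
  exact divisorClasses_powPeriod_eq_hodgeClasses_of_charpoly_eq_cyclotomic_of_totient_le_eight hd hA hP (by omega) k p

end Tori

end ComplexTorus

end Literature.Geometry.Kaehler

end
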